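import Summits.CriticalPhenomena.Ising3DConformalLimit.Theorems.FKParityRobustnessFKFourConnectivityDefs
import Literature.Probability.LatticeModels.LatticeGraph
import Mathlib.Combinatorics.SimpleGraph.Connectivity.Connected

/-!
# Crux `FKFourConnectivity` (stmt-CriticalPhenomena-11254), line `cluster-hole-opacity`:
# two witness paths through a prescribed site of the box (stub `stub_boxWitnessPaths`)

Pure lattice geometry of `ℤ³`.  For `N ≥ R + 1` and sites `A, B, K ∈ Λ_R` of the box `Λ_N` with
`A 0 ≠ B 0` and `K ∉ {A, B}`, there are nearest-neighbour edge sets `P₁` (joining `A` to `K`) and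
`P₂` (joining `K` to `B`) of the box graph `boxGraph N`, touching only vertices of `Λ_{R+1}`, whose
touched vertex sets meet only in `K`.

Construction.  `P₁`: from `A` vertically (coordinate `2`) to the level `T = ±(R+1)`, across at
level `T` (coordinate `0`, then coordinate `1`) to the column of `K`, vertically to `K`.  `P₂`: from
`K` vertically to the opposite level `−T`, across to the column of `B`, vertically to `B`.  The
horizontal parts lie at the two distinct levels `±(R+1)` outside `Λ_R`, so they meet no vertical leg
away from its end at that level; the vertical legs at `A` and at `B` lie in different columns
(`A 0 ≠ B 0`); and the sign of `T` is chosen so that the vertical legs at `A`, `B` miss the two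
vertical legs at `K` (an overlap forces `K` to sit in the column of `A` above `A`, or in the column
of `B` above `B` — not both, the columns being distinct — and then `T = −(R+1)` turns the legs the
other way).  The lattice paths are finally lifted to the box graph (adjacency in
`boxGraph N = (zdGraph 3).comap Subtype.val` is adjacency of the underlying sites).

Every auxiliary statement is an `∃`-statement about explicit finite edge sets of `ℤ³`.
-/

noncomputable section

open Finset
open Literature.Probability.LatticeModels

namespace Summit.CriticalPhenomena.Ising3DConformalLimit.Cruxes.FKFourConnectivity.ClusterHoleOpacity

open scoped Classical

/-! ### Straight legs of `ℤ³` -/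

/-- Consecutive points of a coordinate line are neighbours in `ℤ³`. -/
private theorem bw_adj_update_succ (u : Site 3) (i : Fin 3) (c : ℤ) :
    (zdGraph 3).Adj (Function.update u i c) (Function.update u i (c + 1)) := by
  refine (zdGraph_adj_iff _ _).2 ⟨i, Or.inl ?_⟩
  ext j
  by_cases h : j = i
  · subst h; simp
  · simp [h]

/-- A straight segment of `n` unit steps in the positive `i`-direction: an edge set of `ℤ³` joining
`u` to `u + n • eᵢ`, all of whose vertices lie on that segment. -/
private theorem bw_exists_segment (u : Site 3) (i : Fin 3) (n : ℕ) :
    ∃ T : Finset (Sym2 (Site 3)), (∀ e ∈ T, e ∈ (zdGraph 3).edgeSet) ∧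
      (SimpleGraph.fromEdgeSet (↑T : Set (Sym2 (Site 3)))).Reachable u
        (Function.update u i (u i + n)) ∧
      ∀ e ∈ T, ∀ w ∈ e, (∀ j, j ≠ i → w j = u j) ∧ u i ≤ w i ∧ w i ≤ u i + n := by
  induction n with
  | zero =>
    refine ⟨∅, by simp, ?_, by simp⟩
    rw [Nat.cast_zero, add_zero, Function.update_eq_self]
  | succ n ih =>
    obtain ⟨T, hE, hR, hV⟩ := ih
    have hcast : u i + ((n + 1 : ℕ) : ℤ) = u i + n + 1 := by push_cast; ring
    refine ⟨insert s(Function.update u i (u i + n), Function.update u i (u i + n + 1)) T,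
      ?_, ?_, ?_⟩
    · intro e he
      rcases Finset.mem_insert.1 he with rfl | he
      · exact bw_adj_update_succ u i (u i + n)
      · exact hE e he
    · have hle : SimpleGraph.fromEdgeSet (↑T : Set (Sym2 (Site 3))) ≤
          SimpleGraph.fromEdgeSet
            ↑(insert s(Function.update u i (u i + n), Function.update u i (u i + n + 1)) T) :=
        SimpleGraph.fromEdgeSet_mono (Finset.coe_subset.2 (Finset.subset_insert _ _))
      rw [hcast]
      refine (hR.mono hle).trans (SimpleGraph.Adj.reachable ?_)
      rw [SimpleGraph.fromEdgeSet_adj, Finset.mem_coe]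
      refine ⟨Finset.mem_insert_self _ _, fun h => ?_⟩
      have := congrFun h i
      simp at this
    · intro e he w hw
      rcases Finset.mem_insert.1 he with rfl | he
      · rcases Sym2.mem_iff.1 hw with rfl | rfl
        · refine ⟨fun j hj => by simp [hj], ?_, ?_⟩
          · simp
          · simp only [Function.update_self]; omega
        · refine ⟨fun j hj => by simp [hj], ?_, ?_⟩
          · simp only [Function.update_self]; omega
          · simp only [Function.update_self]; omega
      · obtain ⟨h1, h2, h3⟩ := hV e he w hw
        exact ⟨h1, h2, by omega⟩

/-- A straight leg: an edge set of `ℤ³` joining `u` to the point of its `i`-line with `i`-th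
coordinate `c`, all of whose vertices lie on the `i`-line of `u` between `u i` and `c`. -/
private theorem bw_exists_leg (u : Site 3) (i : Fin 3) (c : ℤ) :
    ∃ T : Finset (Sym2 (Site 3)), (∀ e ∈ T, e ∈ (zdGraph 3).edgeSet) ∧
      (SimpleGraph.fromEdgeSet (↑T : Set (Sym2 (Site 3)))).Reachable u (Function.update u i c) ∧
      ∀ e ∈ T, ∀ w ∈ e, (∀ j, j ≠ i → w j = u j) ∧
        (u i ≤ w i ∧ w i ≤ c ∨ c ≤ w i ∧ w i ≤ u i) := by
  rcases le_or_gt (u i) c with hc | hc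
  · obtain ⟨n, hn⟩ : ∃ n : ℕ, c = u i + n := ⟨(c - u i).toNat, by omega⟩
    obtain ⟨T, hE, hR, hV⟩ := bw_exists_segment u i n
    rw [← hn] at hR
    refine ⟨T, hE, hR, fun e he w hw => ?_⟩
    obtain ⟨h1, h2, h3⟩ := hV e he w hw
    exact ⟨h1, Or.inl ⟨h2, by omega⟩⟩
  · obtain ⟨n, hn⟩ : ∃ n : ℕ, u i = c + n := ⟨(u i - c).toNat, by omega⟩
    obtain ⟨T, hE, hR, hV⟩ := bw_exists_segment (Function.update u i c) i n
    have hvu :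
        Function.update (Function.update u i c) i (Function.update u i c i + (n : ℤ)) = u := by
      rw [Function.update_self, ← hn, Function.update_idem, Function.update_eq_self]
    rw [hvu] at hR
    refine ⟨T, hE, hR.symm, fun e he w hw => ?_⟩
    obtain ⟨h1, h2, h3⟩ := hV e he w hw
    rw [Function.update_self] at h2 h3
    exact ⟨fun j hj => (h1 j hj).trans (by simp [hj]), Or.inr ⟨h2, by omega⟩⟩

/-! ### One witness path of `ℤ³` -/

/-- One witness path: from `A` vertically (direction `2`) to the level `T`, across at level `T`
(direction `0`, then direction `1`) to the column of `K`, vertically to `K` — an edge set of `ℤ³`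
joining `A` to `K`, with the explicit description of the coordinates of its vertices. -/
private theorem bw_exists_latticePath (A K : Site 3) (T : ℤ) :
    ∃ P : Finset (Sym2 (Site 3)), (∀ e ∈ P, e ∈ (zdGraph 3).edgeSet) ∧
      (SimpleGraph.fromEdgeSet (↑P : Set (Sym2 (Site 3)))).Reachable A K ∧
      ∀ e ∈ P, ∀ w ∈ e,
        (w 0 = A 0 ∧ w 1 = A 1 ∧ (A 2 ≤ w 2 ∧ w 2 ≤ T ∨ T ≤ w 2 ∧ w 2 ≤ A 2)) ∨
        (w 2 = T ∧ w 1 = A 1 ∧ (A 0 ≤ w 0 ∧ w 0 ≤ K 0 ∨ K 0 ≤ w 0 ∧ w 0 ≤ A 0)) ∨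
        (w 2 = T ∧ w 0 = K 0 ∧ (A 1 ≤ w 1 ∧ w 1 ≤ K 1 ∨ K 1 ≤ w 1 ∧ w 1 ≤ A 1)) ∨
        (w 0 = K 0 ∧ w 1 = K 1 ∧ (T ≤ w 2 ∧ w 2 ≤ K 2 ∨ K 2 ≤ w 2 ∧ w 2 ≤ T)) := by
  obtain ⟨T₁, hE₁, hR₁, hV₁⟩ := bw_exists_leg A 2 T
  obtain ⟨T₂, hE₂, hR₂, hV₂⟩ := bw_exists_leg (Function.update A 2 T) 0 (K 0)
  obtain ⟨T₃, hE₃, hR₃, hV₃⟩ :=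
    bw_exists_leg (Function.update (Function.update A 2 T) 0 (K 0)) 1 (K 1)
  obtain ⟨T₄, hE₄, hR₄, hV₄⟩ :=
    bw_exists_leg
      (Function.update (Function.update (Function.update A 2 T) 0 (K 0)) 1 (K 1)) 2 (K 2)
  have hK : Function.update
      (Function.update (Function.update (Function.update A 2 T) 0 (K 0)) 1 (K 1)) 2 (K 2)
        = K := by
    ext j; fin_cases j <;> simp
  rw [hK] at hR₄
  have mono : ∀ P : Finset (Sym2 (Site 3)), P ⊆ T₁ ∪ T₂ ∪ T₃ ∪ T₄ →
      SimpleGraph.fromEdgeSet (↑P : Set (Sym2 (Site 3))) ≤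
        SimpleGraph.fromEdgeSet ↑(T₁ ∪ T₂ ∪ T₃ ∪ T₄) :=
    fun P hP => SimpleGraph.fromEdgeSet_mono (Finset.coe_subset.2 hP)
  refine ⟨T₁ ∪ T₂ ∪ T₃ ∪ T₄, ?_, ?_, ?_⟩
  · intro e he
    simp only [Finset.mem_union] at he
    rcases he with ((h | h) | h) | h
    exacts [hE₁ e h, hE₂ e h, hE₃ e h, hE₄ e h]
  · have s₁ : T₁ ⊆ T₁ ∪ T₂ ∪ T₃ ∪ T₄ :=
      subset_union_left.trans (subset_union_left.trans subset_union_left)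
    have s₂ : T₂ ⊆ T₁ ∪ T₂ ∪ T₃ ∪ T₄ :=
      subset_union_right.trans (subset_union_left.trans subset_union_left)
    have s₃ : T₃ ⊆ T₁ ∪ T₂ ∪ T₃ ∪ T₄ := subset_union_right.trans subset_union_left
    have s₄ : T₄ ⊆ T₁ ∪ T₂ ∪ T₃ ∪ T₄ := subset_union_right
    exact (hR₁.mono (mono _ s₁)).trans
      ((hR₂.mono (mono _ s₂)).trans ((hR₃.mono (mono _ s₃)).trans (hR₄.mono (mono _ s₄))))
  · intro e he w hw
    simp only [Finset.mem_union] at he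
    rcases he with ((h | h) | h) | h
    · obtain ⟨h1, h2⟩ := hV₁ e h w hw
      exact Or.inl ⟨h1 0 (by decide), h1 1 (by decide), h2⟩
    · obtain ⟨h1, h2⟩ := hV₂ e h w hw
      have e1 := h1 1 (by decide)
      have e2 := h1 2 (by decide)
      simp at e1 e2 h2
      exact Or.inr (Or.inl ⟨e2, e1, h2⟩)
    · obtain ⟨h1, h2⟩ := hV₃ e h w hw
      have e0 := h1 0 (by decide)
      have e2 := h1 2 (by decide)
      simp at e0 e2 h2
      exact Or.inr (Or.inr (Or.inl ⟨e2, e0, h2⟩))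
    · obtain ⟨h1, h2⟩ := hV₄ e h w hw
      have e0 := h1 0 (by decide)
      have e1 := h1 1 (by decide)
      simp at e0 e1 h2
      exact Or.inr (Or.inr (Or.inr ⟨e0, e1, h2⟩))

/-- The three elements of `Fin 3`. -/
private theorem bw_fin_three : ∀ j : Fin 3, j = 0 ∨ j = 1 ∨ j = 2 := by
  decide

/-- The vertices of a witness path lie in every box containing its endpoints and its level. -/
private theorem bw_latticePath_mem_box {A K w : Site 3} {T : ℤ} {H : ℕ} (hA : A ∈ box 3 H)
    (hK : K ∈ box 3 H) (hT : -(H : ℤ) ≤ T ∧ T ≤ H)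
    (h : (w 0 = A 0 ∧ w 1 = A 1 ∧ (A 2 ≤ w 2 ∧ w 2 ≤ T ∨ T ≤ w 2 ∧ w 2 ≤ A 2)) ∨
      (w 2 = T ∧ w 1 = A 1 ∧ (A 0 ≤ w 0 ∧ w 0 ≤ K 0 ∨ K 0 ≤ w 0 ∧ w 0 ≤ A 0)) ∨
      (w 2 = T ∧ w 0 = K 0 ∧ (A 1 ≤ w 1 ∧ w 1 ≤ K 1 ∨ K 1 ≤ w 1 ∧ w 1 ≤ A 1)) ∨
      (w 0 = K 0 ∧ w 1 = K 1 ∧ (T ≤ w 2 ∧ w 2 ≤ K 2 ∨ K 2 ≤ w 2 ∧ w 2 ≤ T))) :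
    w ∈ box 3 H := by
  rw [mem_box] at hA hK ⊢
  have hA0 := hA 0
  have hA1 := hA 1
  have hA2 := hA 2
  have hK0 := hK 0
  have hK1 := hK 1
  have hK2 := hK 2
  intro j
  rcases bw_fin_three j with rfl | rfl | rfl <;> omega

/-! ### Disjointness arithmetic -/

/-- Arithmetic core of the disjointness of the two witness paths. -/
private theorem bw_witness_arith {a0 a1 a2 b0 b1 b2 k0 k1 k2 w0 w1 w2 T R : ℤ}
    (hAB : a0 ≠ b0) (hAK : k0 ≠ a0 ∨ k1 ≠ a1 ∨ k2 ≠ a2) (hBK : k0 ≠ b0 ∨ k1 ≠ b1 ∨ k2 ≠ b2)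
    (hA2 : -R ≤ a2 ∧ a2 ≤ R) (hB2 : -R ≤ b2 ∧ b2 ≤ R) (hK2 : -R ≤ k2 ∧ k2 ≤ R) (hR : 0 ≤ R)
    (hT : (T = R + 1 ∧ ¬((k0 = a0 ∧ k1 = a1 ∧ a2 < k2) ∨ (k0 = b0 ∧ k1 = b1 ∧ k2 < b2))) ∨
      (T = -(R + 1) ∧ ((k0 = a0 ∧ k1 = a1 ∧ a2 < k2) ∨ (k0 = b0 ∧ k1 = b1 ∧ k2 < b2))))
    (r1 : (w0 = a0 ∧ w1 = a1 ∧ (a2 ≤ w2 ∧ w2 ≤ T ∨ T ≤ w2 ∧ w2 ≤ a2)) ∨ w2 = T ∨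
      (w0 = k0 ∧ w1 = k1 ∧ (T ≤ w2 ∧ w2 ≤ k2 ∨ k2 ≤ w2 ∧ w2 ≤ T)))
    (r2 : (w0 = k0 ∧ w1 = k1 ∧ (k2 ≤ w2 ∧ w2 ≤ -T ∨ -T ≤ w2 ∧ w2 ≤ k2)) ∨ w2 = -T ∨
      (w0 = b0 ∧ w1 = b1 ∧ (-T ≤ w2 ∧ w2 ≤ b2 ∨ b2 ≤ w2 ∧ w2 ≤ -T))) :
    w0 = k0 ∧ w1 = k1 ∧ w2 = k2 := by
  rcases hT with ⟨rfl, hnb⟩ | ⟨rfl, hb⟩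
  · rcases r1 with r1 | r1 | r1 <;> rcases r2 with r2 | r2 | r2 <;> omega
  · rcases r1 with r1 | r1 | r1 <;> rcases r2 with r2 | r2 | r2 <;> omega

/-- Distinct lattice points differ in some coordinate. -/
private theorem bw_coord_ne_of_ne {X Y : Site 3} (h : X ≠ Y) :
    X 0 ≠ Y 0 ∨ X 1 ≠ Y 1 ∨ X 2 ≠ Y 2 := by
  by_contra hc
  push Not at hc
  exact h (by
    ext j; fin_cases j
    · exact hc.1
    · exact hc.2.1
    · exact hc.2.2)

/-- The coarse form of the vertex description of a witness path used for disjointness: a vertex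
lies on the vertical leg at `A`, at the level `T`, or on the vertical leg at `K`. -/
private theorem bw_coarse {A K w : Site 3} {T : ℤ}
    (h : (w 0 = A 0 ∧ w 1 = A 1 ∧ (A 2 ≤ w 2 ∧ w 2 ≤ T ∨ T ≤ w 2 ∧ w 2 ≤ A 2)) ∨
      (w 2 = T ∧ w 1 = A 1 ∧ (A 0 ≤ w 0 ∧ w 0 ≤ K 0 ∨ K 0 ≤ w 0 ∧ w 0 ≤ A 0)) ∨
      (w 2 = T ∧ w 0 = K 0 ∧ (A 1 ≤ w 1 ∧ w 1 ≤ K 1 ∨ K 1 ≤ w 1 ∧ w 1 ≤ A 1)) ∨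
      (w 0 = K 0 ∧ w 1 = K 1 ∧ (T ≤ w 2 ∧ w 2 ≤ K 2 ∨ K 2 ≤ w 2 ∧ w 2 ≤ T))) :
    (w 0 = A 0 ∧ w 1 = A 1 ∧ (A 2 ≤ w 2 ∧ w 2 ≤ T ∨ T ≤ w 2 ∧ w 2 ≤ A 2)) ∨ w 2 = T ∨
      (w 0 = K 0 ∧ w 1 = K 1 ∧ (T ≤ w 2 ∧ w 2 ≤ K 2 ∨ K 2 ≤ w 2 ∧ w 2 ≤ T)) := by
  rcases h with h | h | h | h
  exacts [Or.inl h, Or.inr (Or.inl h.1), Or.inr (Or.inl h.1), Or.inr (Or.inr h)]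

/-! ### Lifting lattice paths to the box graph -/

/-- Lattice connections inside `Λ_N` lift to connections of the box graph along the edges of
`boxGraph N` lying over the lattice edge set. -/
private theorem bw_reachable_lift {N : ℕ} {T : Finset (Sym2 (Site 3))}
    (hT : ∀ e ∈ T, e ∈ (zdGraph 3).edgeSet) (hbox : ∀ e ∈ T, ∀ w ∈ e, w ∈ box 3 N)
    {x y : Site 3} (h : (SimpleGraph.fromEdgeSet (↑T : Set (Sym2 (Site 3)))).Reachable x y)
    (hx : x ∈ box 3 N) (hy : y ∈ box 3 N) :
    (SimpleGraph.fromEdgeSet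
      (↑((boxGraph N).edgeFinset.filter fun e => e.map Subtype.val ∈ T) :
        Set (Sym2 ↥(box 3 N)))).Reachable ⟨x, hx⟩ ⟨y, hy⟩ := by
  obtain ⟨w⟩ := h
  suffices H : ∀ (x y : Site 3) (_ : (SimpleGraph.fromEdgeSet (↑T : Set (Sym2 (Site 3)))).Walk x y)
      (hx : x ∈ box 3 N) (hy : y ∈ box 3 N),
      (SimpleGraph.fromEdgeSet
        (↑((boxGraph N).edgeFinset.filter fun e => e.map Subtype.val ∈ T) :
          Set (Sym2 ↥(box 3 N)))).Reachable ⟨x, hx⟩ ⟨y, hy⟩ from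
    H x y w hx hy
  intro x y w
  induction w with
  | nil => intro hx hy; exact SimpleGraph.Reachable.refl _
  | @cons x z y hadj w' ih =>
    intro hx hy
    rw [SimpleGraph.fromEdgeSet_adj, Finset.mem_coe] at hadj
    have hz : z ∈ box 3 N := hbox _ hadj.1 z (Sym2.mem_mk_right x z)
    refine (SimpleGraph.Adj.reachable ?_).trans (ih hz hy)
    rw [SimpleGraph.fromEdgeSet_adj, Finset.mem_coe]
    refine ⟨?_, fun h => hadj.2 (congrArg Subtype.val h)⟩
    rw [Finset.mem_filter, SimpleGraph.mem_edgeFinset, SimpleGraph.mem_edgeSet, Sym2.map_mk]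
    exact ⟨hT _ hadj.1, hadj.1⟩

/-! ### The registered stub -/

/-- Registered stub `stub_boxWitnessPaths` of the skeleton `Lines/cluster-hole-opacity.lean` (crux
`FKFourConnectivity`, stmt-CriticalPhenomena-11254) — **two lattice paths of the box meeting only
at `K`** (the geometric input of single-site opacity in a box): for `N ≥ R + 1` and sites
`A, B, K ∈ Λ_R` of `Λ_N` with `A 0 ≠ B 0` and `K ∉ {A, B}`, there are nearest-neighbour edge sets
`P₁` (joining `A` to `K`) and `P₂` (joining `K` to `B`) of the box graph `boxGraph N`, touching
only vertices of `Λ_{R+1}`, whose touched vertex sets meet only in `K`: go from `A` vertically to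
the level `±(R+1)`, across, and vertically to `K`; leave `K` vertically to the opposite level,
across, and vertically to `B` (the sign is chosen so that the vertical legs at `A`, `B` miss those
at `K`); then lift the two lattice paths to the box graph. -/
theorem stub_boxWitnessPaths :
    ∀ (R N : ℕ), R + 1 ≤ N → ∀ (A B K : ↥(box 3 N)), (A : Site 3) 0 ≠ (B : Site 3) 0 → A ≠ K →
      B ≠ K → (A : Site 3) ∈ box 3 R → (B : Site 3) ∈ box 3 R → (K : Site 3) ∈ box 3 R →
      ∃ P₁ P₂ : Finset (Sym2 ↥(box 3 N)),
        P₁ ⊆ (boxGraph N).edgeFinset ∧ P₂ ⊆ (boxGraph N).edgeFinset ∧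
        (∀ e ∈ P₁, ∀ w ∈ e, (w : Site 3) ∈ box 3 (R + 1)) ∧
        (∀ e ∈ P₂, ∀ w ∈ e, (w : Site 3) ∈ box 3 (R + 1)) ∧
        (SimpleGraph.fromEdgeSet (↑P₁ : Set (Sym2 ↥(box 3 N)))).Reachable A K ∧
        (SimpleGraph.fromEdgeSet (↑P₂ : Set (Sym2 ↥(box 3 N)))).Reachable K B ∧
        ∀ w : ↥(box 3 N), (∃ e ∈ P₁, w ∈ e) → (∃ e ∈ P₂, w ∈ e) → w = K := by
  rintro R N hRN ⟨A, hAN⟩ ⟨B, hBN⟩ ⟨K, hKN⟩ hAB hAK hBK hA hB hK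
  simp only [Ne, Subtype.mk.injEq] at hAK hBK
  change A 0 ≠ B 0 at hAB
  change A ∈ box 3 R at hA
  change B ∈ box 3 R at hB
  change K ∈ box 3 R at hK
  -- the level of the horizontal part of the first path (the second one uses `-T`)
  obtain ⟨T, hTval⟩ : ∃ T : ℤ,
      (T = (R : ℤ) + 1 ∧ ¬((K 0 = A 0 ∧ K 1 = A 1 ∧ A 2 < K 2) ∨
        (K 0 = B 0 ∧ K 1 = B 1 ∧ K 2 < B 2))) ∨
      (T = -((R : ℤ) + 1) ∧ ((K 0 = A 0 ∧ K 1 = A 1 ∧ A 2 < K 2) ∨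
        (K 0 = B 0 ∧ K 1 = B 1 ∧ K 2 < B 2))) := by
    by_cases h : (K 0 = A 0 ∧ K 1 = A 1 ∧ A 2 < K 2) ∨ (K 0 = B 0 ∧ K 1 = B 1 ∧ K 2 < B 2)
    · exact ⟨_, Or.inr ⟨rfl, h⟩⟩
    · exact ⟨_, Or.inl ⟨rfl, h⟩⟩
  have hT : -((R + 1 : ℕ) : ℤ) ≤ T ∧ T ≤ ((R + 1 : ℕ) : ℤ) := by push_cast; omega
  have hT' : -((R + 1 : ℕ) : ℤ) ≤ -T ∧ -T ≤ ((R + 1 : ℕ) : ℤ) := by push_cast; omega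
  have hA' : A ∈ box 3 (R + 1) := box_mono 3 (Nat.le_succ R) hA
  have hB' : B ∈ box 3 (R + 1) := box_mono 3 (Nat.le_succ R) hB
  have hK' : K ∈ box 3 (R + 1) := box_mono 3 (Nat.le_succ R) hK
  -- the two lattice paths
  obtain ⟨L₁, hE₁, hR₁, hV₁⟩ := bw_exists_latticePath A K T
  obtain ⟨L₂, hE₂, hR₂, hV₂⟩ := bw_exists_latticePath K B (-T)
  have hbox₁ : ∀ e ∈ L₁, ∀ w ∈ e, w ∈ box 3 (R + 1) := fun e he w hw =>
    bw_latticePath_mem_box hA' hK' hT (hV₁ e he w hw)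
  have hbox₂ : ∀ e ∈ L₂, ∀ w ∈ e, w ∈ box 3 (R + 1) := fun e he w hw =>
    bw_latticePath_mem_box hK' hB' hT' (hV₂ e he w hw)
  have hboxN₁ : ∀ e ∈ L₁, ∀ w ∈ e, w ∈ box 3 N := fun e he w hw =>
    box_mono 3 hRN (hbox₁ e he w hw)
  have hboxN₂ : ∀ e ∈ L₂, ∀ w ∈ e, w ∈ box 3 N := fun e he w hw =>
    box_mono 3 hRN (hbox₂ e he w hw)
  -- their lifts to the box graph
  refine ⟨(boxGraph N).edgeFinset.filter (fun e => e.map Subtype.val ∈ L₁),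
    (boxGraph N).edgeFinset.filter (fun e => e.map Subtype.val ∈ L₂),
    Finset.filter_subset _ _, Finset.filter_subset _ _, ?_, ?_,
    bw_reachable_lift hE₁ hboxN₁ hR₁ hAN hKN, bw_reachable_lift hE₂ hboxN₂ hR₂ hKN hBN, ?_⟩
  · intro e he w hw
    exact hbox₁ _ (Finset.mem_filter.1 he).2 _ (Sym2.mem_map.2 ⟨w, hw, rfl⟩)
  · intro e he w hw
    exact hbox₂ _ (Finset.mem_filter.1 he).2 _ (Sym2.mem_map.2 ⟨w, hw, rfl⟩)
  · rintro w ⟨e₁, he₁, hw₁⟩ ⟨e₂, he₂, hw₂⟩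
    have r1 := bw_coarse (hV₁ _ (Finset.mem_filter.1 he₁).2 _ (Sym2.mem_map.2 ⟨w, hw₁, rfl⟩))
    have r2 := bw_coarse (hV₂ _ (Finset.mem_filter.1 he₂).2 _ (Sym2.mem_map.2 ⟨w, hw₂, rfl⟩))
    rw [mem_box] at hA hB hK
    have h := bw_witness_arith hAB (bw_coord_ne_of_ne (Ne.symm hAK))
      (bw_coord_ne_of_ne (Ne.symm hBK)) (hA 2) (hB 2) (hK 2) (Int.natCast_nonneg R) hTval r1 r2
    apply Subtype.ext
    ext j; fin_cases j
    · exact h.1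
    · exact h.2.1
    · exact h.2.2

end Summit.CriticalPhenomena.Ising3DConformalLimit.Cruxes.FKFourConnectivity.ClusterHoleOpacity

end
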